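import Summits.QuantumFields.BalabanUV.Beta.FP.ScaledResolventSandwich
import Summits.QuantumFields.BalabanUV.Beta.FP.WSlotSplit
import Summits.QuantumFields.BalabanUV.Beta.D1BFx.Criticality
import Summits.QuantumFields.BalabanUV.Beta.FP.BiVertexSlotLetters

/-!
# `BalabanUV.Beta.FP.TransportFineFactor` — road «FP» for binder row D1, W-ORACLE-K row **TRANSPORT′** (RULING R-FP-48, journal l.35450: «fine factor along ψ =
# `RP m + CROSS m`»; first refusal leaf-02), GENERIC FORM: THE ONE-STEP HESSIAN KERNEL TRANSPORTED BY A COLUMN KERNEL PLUS THE `T₁`-LINEAR CROSS TERM —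
# `hessKer G (vertexOfK C n V₁) (vertex2OfK C n W₁ + X) μ ν z = dressedEntry (colOf C) (hessKer G V₁ W₁) (n•z) μ ν + Σ_κ Σ'_u ψ₂ μ 0 ν z κ u · ½·tadpole G (V₁ κ u)`

HONEST DEPENDENCY (page 1, mandatory): continuum YM on T⁴ ⇐ BetaPertH ∧ nine spine estimates (0/9 proved); BetaPertH ⇐ (D1) ∧ (D4) ∧ CAP+tail;
G-an2-4 gates asym, D1 and NE2/3/4.  HONEST FRAMING (cell contract, verbatim): «discharging `BetaPertH` makes Bałaban's UV stability UNCONDITIONAL —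
a real constructive-QFT result; it is NOT the continuum limit and NOT the Clay problem.»  THIS MODULE is [folklore] re-indexing + the landed W-slot additivity
and tadpole Fubini BY NAME (`ScaledResolventSandwich.hessKer_vertexOfK_vertex2OfK_eq_dressedEntryP_scaled` (T0), `WSlotSplit.hessKer_add_W`, D1BFx
`Criticality.tadpole_wsum`); GENERIC kernels — nothing of the perfect objects instantiated; no `def`, no `def … : Prop`, nothing cited, 0 sorry; 0∕4 row-D1
binders; NOT TRANSPORT′ for the literal (its instance needs SLOT′'s jets, (K-fm) ✓, (K-fm₂)'s second summand `ψ̈`, TAD-INST(-M) and the unit factor of `RP m`),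
NOT SDF, NOT D1, NOT BetaPertH, NOT continuum, NOT Clay.  «not in print; our bookkeeping».

ABSOLUTE RULE (cell charter, verbatim): «No internally-minted statement may enter as a cited fact. Every hypothesis is either kernel-proved in this package or a
verbatim quotation of a PUBLISHED theorem with page reference. The manuscript(s) under audit are NOT citable for their own disputed steps — they are the thing
under adjudication; programme-internal (2001/route/tribunal) claims are never citable.»

WHY (R-FP-48 (1): along the composite minimiser the FINE determinant factor is `F₁ ∘ ψ` with `ψ` the m-fold coarse minimiser, so its second variation is
`F₁″[ψ̇, ψ̇] + F₁′[ψ̈]`; `ψ̇` = the field columns `colOf (KPerf m)` (the END's `dressedEntry` transport), `ψ̈` = the coarse second response, `F₁′ = T₁` =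
TAD-INST's one-point function).  In kernels: the fine factor's first jet is `vertexOfK C n V₁` (`V₁` = the ONE-STEP first jets `dM₁`, (F-V)
`ColumnSemigroupVertexNesting`), its second jet is `vertex2OfK C n W₁ + X` with `X μ y ν y′ := Σ_κ wsum (ψ₂ μ y ν y′ κ) (V₁ κ)` (one-step second jets
transported on both legs, plus first jets weighted by `ψ̈`).  This file: (i) (T0)'s sandwich in the END's `dressedEntry ∕ colOf` currency (translation-covariant
one-step jets; re-indexing `(u, x) ↦ (−u, −x)`, NO transposition symmetry, NO unit factor), (ii) the `X`-word is `½·Σ ψ₂·tadpole G (V₁ κ u)` — `T₁`-LINEAR —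
so row TAD kills it from `tadpole G (V₁ κ u) = 0`.

CONTENT ([folklore]; `d + 1 = 4`):
* §1 `fineHessA_eq_hessKer_of_transl` (translation-covariant jets ⇒ `fineHessA G V₁ W₁ c e s s′ = hessKer G V₁ W₁ c e (s′ − s)`),
  `dressedEntryP_colH_eq_dressedEntry_colOf` (the END's currency), **`hessKer_nest_eq_dressedEntry`** ((T0) in `dressedEntry (colOf C)` form).
* §2 `tadpole_wsum_scaled` (Fubini for a family localised at `L•u`, by dilation), **`hessKer_nest_add_eq_transport_add_cross`** (the fine factor along ψ:
  transport + `T₁`-linear cross term), **`hessKer_nest_add_eq_transport_of_tadpoleFree`** (`T₁ ≡ 0` ⇒ pure transport).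
Provenance: unit `b2b-balaban-beta-d1-formalise-leaf-02` gen 15 (prover-b2b-balaban-beta-d1-formalise-leaf-02-g15-0), 2026-08-21; new file, nothing appended to others' modules.
-/

noncomputable section

namespace Summit.QuantumFields.BalabanUV.Beta.FP.TransportFineFactor

open Finset Filter Topology
open scoped BigOperators
open Literature.MathematicalPhysics.QuantumFieldTheory.Balaban1983to89
open Literature.MathematicalPhysics.QuantumFieldTheory.Balaban1983to89.Beta
open B12Sec2to5 (l1 l1_nonneg)
open ExpKernelCalculus (Site MKer Decays BiLoc comp tr bubble tadpole hessKer shiftK l1_natSmul bubble_shiftK tadpole_shiftK)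
open DecimatedMomentSummable (AbsMoment₂ dressedSum)
open DressedMomentNormalisation (EKer dressedEntry)
open OneStepResolventKernel (Fib wsum LocStencil)
open OneStepKernelFamily (colH vertexOfK)
open SecondOrderResponse (vertex2OfK)
open Summit.QuantumFields.BalabanUV.Beta.TameKernelCalculus (Spr Loc)
open Summit.QuantumFields.BalabanUV.Beta.D1BFx.MomentTransferPeriodicSum (dressedSumP)
open Summit.QuantumFields.BalabanUV.Beta.D1BFx.MomentTransferPeriodicEntry (EKer₂ dressedEntryP)
open Summit.QuantumFields.BalabanUV.Beta.D1BFx.DressedTablesLeg (tadpoleTableA_apply bubbleTableA_apply)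
open Summit.QuantumFields.BalabanUV.Beta.D1BFx.ReducedKernelSandwichLeg (fineHessA fineHessA_apply)
open Summit.QuantumFields.BalabanUV.Beta.FP.TransportInfinityM (colOf colOf_apply)
open Summit.QuantumFields.BalabanUV.Beta.FP.PerfectBubbleSandwich (colH_zero_eq_colOf_neg)
open Summit.QuantumFields.BalabanUV.Beta.FP.ScaledResolventSandwichLetters (zsmul_injective wsum_extend colH_extend₂ decays_extend₂ biLoc_extend₂
  vertex2OfK_of_colH_extend)
open Summit.QuantumFields.BalabanUV.Beta.FP.BiVertexSlotLetters (loc_vertex2OfK_of_biLoc)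
open Summit.QuantumFields.BalabanUV.Beta.KernelWardRelative (loc_finset_sum tadpole_finset_sum)
open Summit.QuantumFields.BalabanUV.Beta.FP.ScaledResolventSandwich (hessKer_vertexOfK_vertex2OfK_eq_dressedEntryP_scaled)
open Summit.QuantumFields.BalabanUV.Beta.FP.WSlotSplit (hessKer_add_W)

variable {L : ℕ} [NeZero L]

/-! ## §1 The transported word in the END's currency -/

section Currency

variable {n : ℕ} {G C : MKer (3 + 1) (Fib 3)}
  {V₁ : Fin (3 + 1) → Site (3 + 1) → MKer (3 + 1) (Fib 3)}
  {W₁ : Fin (3 + 1) → Site (3 + 1) → Fin (3 + 1) → Site (3 + 1) → MKer (3 + 1) (Fib 3)}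

omit [NeZero L] in
/-- [folklore] **TRANSLATION-COVARIANT ONE-STEP JETS GIVE A TRANSLATION-INVARIANT FINE KERNEL**: if `G` is `L`-periodic and the jets shift with their index
(`V₁ κ (u + t) = shiftK (−(L•t)) (V₁ κ u)`, `W₁` jointly likewise, ALL `t`), then `fineHessA G V₁ W₁ c e s s′ = hessKer G V₁ W₁ c e (s′ − s)`. -/
theorem fineHessA_eq_hessKer_of_transl (hGcov : ∀ t : Site (3 + 1), shiftK (-((L : ℤ) • t)) G = G)
    (hVcov : ∀ κ u t, V₁ κ (u + t) = shiftK (-((L : ℤ) • t)) (V₁ κ u))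
    (hWcov : ∀ κ u l u' t, W₁ κ (u + t) l (u' + t) = shiftK (-((L : ℤ) • t)) (W₁ κ u l u'))
    (c e : Fin (3 + 1)) (s s' : Site (3 + 1)) :
    fineHessA G V₁ W₁ c e s s' = hessKer G V₁ W₁ c e (s' - s) := by
  rw [fineHessA_apply, tadpoleTableA_apply, bubbleTableA_apply]
  simp only [ExpKernelCalculus.hessKer]
  have hW : W₁ c s e s' = shiftK (-((L : ℤ) • s)) (W₁ c 0 e (s' - s)) := by
    have h := hWcov c 0 e (s' - s) s
    rwa [zero_add, sub_add_cancel] at h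
  have hV1 : V₁ c s = shiftK (-((L : ℤ) • s)) (V₁ c 0) := by
    have h := hVcov c 0 s
    rwa [zero_add] at h
  have hV2 : V₁ e s' = shiftK (-((L : ℤ) • s)) (V₁ e (s' - s)) := by
    have h := hVcov e (s' - s) s
    rwa [sub_add_cancel] at h
  rw [hW, hV1, hV2, ← hGcov s, tadpole_shiftK, bubble_shiftK, hGcov s]
  ring

/-- [folklore] **THE SANDWICH IN THE END's CURRENCY**: for a translation-invariant fine kernel `P c e s s′ = T c e (s′ − s)`,
`dressedEntryP (c a ↦ colH C n a 0 c) P (n•(−z)) μ ν = dressedEntry (colOf C) T (n•z) μ ν` (`colH C n a 0 c u = colOf C c a (−u)`; re-index `(u,x) ↦ (−u,−x)`). -/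
theorem dressedEntryP_colH_eq_dressedEntry_colOf (C : MKer (3 + 1) (Fib 3)) (n : ℕ) (T : EKer 4) (z : Site (3 + 1)) (μ ν : Fin (3 + 1)) :
    dressedEntryP (fun c a => colH C n a 0 c) (fun c e s s' => T c e (s' - s)) ((n : ℤ) • (-z)) μ ν
      = dressedEntry (colOf C) T ((n : ℤ) • z) μ ν := by
  simp only [dressedEntryP, dressedSumP, dressedEntry, dressedSum]
  refine Finset.sum_congr rfl fun c _ => Finset.sum_congr rfl fun e _ => ?_
  rw [← (Equiv.neg ((Site (3 + 1)) × (Site (3 + 1)))).tsum_eq]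
  refine tsum_congr fun p => ?_
  simp only [Equiv.neg_apply, Prod.fst_neg, Prod.snd_neg, colH_zero_eq_colOf_neg, neg_neg, smul_neg]
  congr 2
  congr 1
  abel

/-- [folklore] **THE NESTED ONE-LOOP KERNEL IS THE TRANSPORTED ONE-STEP KERNEL** ((T0) in the END's currency): leg `G` (`spread`, `L`-periodic), column kernel
`C` at blocking `n` on the `L`-lattice (decaying, `n`-block-covariant, `AbsMoment₂` columns), one-step jets `V₁`, `W₁` localised at `L•u` and TRANSLATION-covariant:
`hessKer G (vertexOfK C n V₁) (vertex2OfK C n W₁) μ ν z = dressedEntry (colOf C) (hessKer G V₁ W₁) (n•z) μ ν`. -/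
theorem hessKer_nest_eq_dressedEntry (hn : 1 ≤ n) (hG : Spr G) (hGcov : ∀ t : Site (3 + 1), shiftK (-((L : ℤ) • t)) G = G)
    {CC δ Cs δs C2 δ2 : ℝ}
    (hC : Decays C CC δ) (hδ : 0 < δ) (hCcov : ∀ t : Site (3 + 1), shiftK (-((n : ℤ) • t)) C = C)
    (hwA : ∀ κ l : Fin 4, AbsMoment₂ (colOf C κ l))
    (hV : ∀ κ u, BiLoc (V₁ κ u) ((L : ℤ) • u) ((L : ℤ) • u) Cs δs) (hδs : 0 < δs)
    (hVcov : ∀ κ u t, V₁ κ (u + t) = shiftK (-((L : ℤ) • t)) (V₁ κ u))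
    (hW : ∀ κ u l u', BiLoc (W₁ κ u l u') ((L : ℤ) • u) ((L : ℤ) • u') C2 δ2) (hδ2 : 0 < δ2)
    (hWcov : ∀ κ u l u' t, W₁ κ (u + t) l (u' + t) = shiftK (-((L : ℤ) • t)) (W₁ κ u l u'))
    (μ ν : Fin (3 + 1)) (z : Site (3 + 1)) :
    hessKer G (vertexOfK C n V₁) (vertex2OfK C n W₁) μ ν z = dressedEntry (colOf C) (hessKer G V₁ W₁) ((n : ℤ) • z) μ ν := by
  -- block covariance at blocking `n·L` from full translation covariance
  have hmul : ∀ t : Site (3 + 1), (((n * L : ℕ) : ℤ)) • t = (L : ℤ) • ((n : ℤ) • t) := fun t => by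
    rw [smul_smul, mul_comm]; push_cast; rfl
  have hGcov' : ∀ t : Site (3 + 1), shiftK (-(((n * L : ℕ) : ℤ) • t)) G = G := fun t => by rw [hmul]; exact hGcov _
  have hVcov' : ∀ κ u t, V₁ κ (u + (n : ℤ) • t) = shiftK (-(((n * L : ℕ) : ℤ) • t)) (V₁ κ u) := fun κ u t => by
    rw [hmul]; exact hVcov κ u _
  have hWcov' : ∀ κ u l u' t, W₁ κ (u + (n : ℤ) • t) l (u' + (n : ℤ) • t) = shiftK (-(((n * L : ℕ) : ℤ) • t)) (W₁ κ u l u') :=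
    fun κ u l u' t => by rw [hmul]; exact hWcov κ u l u' _
  rw [hessKer_vertexOfK_vertex2OfK_eq_dressedEntryP_scaled (L := L) hn hG hGcov' hC hδ hCcov hwA hV hδs hVcov' hW hδ2 hWcov' μ ν z]
  have hP : fineHessA G V₁ W₁ = fun c e s s' => hessKer G V₁ W₁ c e (s' - s) := by
    funext c e s s'
    exact fineHessA_eq_hessKer_of_transl hGcov hVcov hWcov c e s s'
  rw [hP]
  exact dressedEntryP_colH_eq_dressedEntry_colOf C n (hessKer G V₁ W₁) z μ ν

end Currency

/-! ## §2 The cross term: the first jets weighted by the coarse second response -/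

section Cross

variable {n : ℕ} {G C : MKer (3 + 1) (Fib 3)}
  {V₁ : Fin (3 + 1) → Site (3 + 1) → MKer (3 + 1) (Fib 3)}
  {W₁ : Fin (3 + 1) → Site (3 + 1) → Fin (3 + 1) → Site (3 + 1) → MKer (3 + 1) (Fib 3)}

/-- [folklore] **FUBINI FOR THE TADPOLE OF A SUPERPOSITION OF A FAMILY LOCALISED AT `L•u`**: spread `G`, weights decaying exponentially from a point, family
`V u` bi-localised at `(L•u, L•u)` ⟹ `tadpole G (wsum w V) = Σ'_u w u · tadpole G (V u)` (D1BFx `Criticality.tadpole_wsum` at the dilated data). -/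
theorem tadpole_wsum_scaled (hG : Spr G) {w : Site (3 + 1) → ℝ} {V : Site (3 + 1) → MKer (3 + 1) (Fib 3)} {Cw m Cs δs : ℝ}
    {p : Site (3 + 1)} (hm : 0 < m) (hw : ∀ u, |w u| ≤ Cw * Real.exp (-m * l1 (u - p)))
    (hV : ∀ u, BiLoc (V u) ((L : ℤ) • u) ((L : ℤ) • u) Cs δs) (hδs : 0 < δs) :
    tadpole G (wsum w V) = ∑' u, w u * tadpole G (V u) := by
  have hL : (0 : ℝ) < L := by exact_mod_cast Nat.pos_of_ne_zero (NeZero.ne L)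
  have hCs : 0 ≤ Cs := (hV p).nonneg (Sum.inl 0)
  -- dilate
  rw [← wsum_extend (L := L) w V]
  have hw' : ∀ v, |Function.extend (fun u : Site (3 + 1) => (L : ℤ) • u) w 0 v| ≤ |Cw| * Real.exp (-(m / L) * l1 (v - (L : ℤ) • p)) := by
    intro v
    by_cases hv : ∃ u : Site (3 + 1), (L : ℤ) • u = v
    · obtain ⟨u, rfl⟩ := hv
      rw [(zsmul_injective (L := L)).extend_apply, ← smul_sub, l1_natSmul]
      refine (hw u).trans ?_
      have e : -(m / L) * ((L : ℝ) * l1 (u - p)) = -m * l1 (u - p) := by field_simp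
      rw [e]
      exact mul_le_mul_of_nonneg_right (le_abs_self Cw) (Real.exp_pos _).le
    · rw [Function.extend_apply' _ _ _ hv]
      simp only [Pi.zero_apply, abs_zero]
      positivity
  have hV' : ∀ v, BiLoc (Function.extend (fun u : Site (3 + 1) => (L : ℤ) • u) V 0 v) v v Cs δs := by
    intro v
    by_cases hv : ∃ u : Site (3 + 1), (L : ℤ) • u = v
    · obtain ⟨u, rfl⟩ := hv
      rw [(zsmul_injective (L := L)).extend_apply]
      exact hV u
    · rw [Function.extend_apply' _ _ _ hv]
      intro x z a b
      simp only [Pi.zero_apply, abs_zero]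
      positivity
  rw [Summit.QuantumFields.BalabanUV.Beta.D1BFx.Criticality.tadpole_wsum hG (div_pos hm hL) hw' hδs hV',
    ← tsum_extend_zero (zsmul_injective (L := L)) (fun u => w u * tadpole G (V u))]
  refine tsum_congr fun v => ?_
  by_cases hv : ∃ u : Site (3 + 1), (L : ℤ) • u = v
  · obtain ⟨u, rfl⟩ := hv
    rw [(zsmul_injective (L := L)).extend_apply, (zsmul_injective (L := L)).extend_apply, (zsmul_injective (L := L)).extend_apply]
  · rw [Function.extend_apply' _ _ _ hv, Function.extend_apply' _ _ _ hv, Function.extend_apply' _ _ _ hv]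
    simp

/-- [folklore] **THE FINE FACTOR ALONG ψ = TRANSPORT + `T₁`-LINEAR CROSS TERM** (R-FP-48's TRANSPORT′, generic): with the data of
`hessKer_nest_eq_dressedEntry` and ANY weight family `ψ₂ μ y ν y′ κ u` (the coarse second response `ψ̈`; decaying from a point in `u`), put
`X μ y ν y′ := Σ_κ wsum (ψ₂ μ y ν y′ κ) (V₁ κ)` (the one-step FIRST jets weighted by `ψ̈`); then
`hessKer G (vertexOfK C n V₁) (vertex2OfK C n W₁ + X) μ ν z = dressedEntry (colOf C) (hessKer G V₁ W₁) (n•z) μ ν + Σ_κ Σ'_u ψ₂ μ 0 ν z κ u · (½·tadpole G (V₁ κ u))` —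
the second summand is LINEAR in the one-point function `b₁ ↦ ½·tadpole G (V₁ b₁)`. -/
theorem hessKer_nest_add_eq_transport_add_cross (hn : 1 ≤ n) (hG : Spr G) (hGcov : ∀ t : Site (3 + 1), shiftK (-((L : ℤ) • t)) G = G)
    {CC δ Cs δs C2 δ2 Cψ mψ : ℝ}
    (hC : Decays C CC δ) (hδ : 0 < δ) (hCcov : ∀ t : Site (3 + 1), shiftK (-((n : ℤ) • t)) C = C)
    (hwA : ∀ κ l : Fin 4, AbsMoment₂ (colOf C κ l))
    (hV : ∀ κ u, BiLoc (V₁ κ u) ((L : ℤ) • u) ((L : ℤ) • u) Cs δs) (hδs : 0 < δs)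
    (hVcov : ∀ κ u t, V₁ κ (u + t) = shiftK (-((L : ℤ) • t)) (V₁ κ u))
    (hW : ∀ κ u l u', BiLoc (W₁ κ u l u') ((L : ℤ) • u) ((L : ℤ) • u') C2 δ2) (hδ2 : 0 < δ2)
    (hWcov : ∀ κ u l u' t, W₁ κ (u + t) l (u' + t) = shiftK (-((L : ℤ) • t)) (W₁ κ u l u'))
    (ψ₂ : Fin (3 + 1) → Site (3 + 1) → Fin (3 + 1) → Site (3 + 1) → Fin (3 + 1) → Site (3 + 1) → ℝ) (hmψ : 0 < mψ)
    (hψ : ∀ μ y ν y' κ, ∃ p : Site (3 + 1), ∀ u, |ψ₂ μ y ν y' κ u| ≤ Cψ * Real.exp (-mψ * l1 (u - p)))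
    (μ ν : Fin (3 + 1)) (z : Site (3 + 1)) :
    hessKer G (vertexOfK C n V₁) (vertex2OfK C n W₁ + fun μ y ν y' => fun x z' a b => ∑ κ, wsum (ψ₂ μ y ν y' κ) (V₁ κ) x z' a b) μ ν z
      = dressedEntry (colOf C) (hessKer G V₁ W₁) ((n : ℤ) • z) μ ν
        + ∑ κ, ∑' u, ψ₂ μ 0 ν z κ u * ((1 / 2 : ℝ) * tadpole G (V₁ κ u)) := by
  have hCs : 0 ≤ Cs := (hV 0 0).nonneg (Sum.inl 0)
  have hL : (0 : ℝ) < L := by exact_mod_cast Nat.pos_of_ne_zero (NeZero.ne L)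
  -- localisation of the bi-vertex member at `(μ, 0; ν, z)`: through the dilated data
  have h₀ : Loc (vertex2OfK C n W₁ μ 0 ν z) := by
    rw [← vertex2OfK_of_colH_extend (L := L) (fun μ' y' κ' => colH_extend₂ (C := C) μ' y' κ') W₁ μ 0 ν z]
    exact loc_vertex2OfK_of_biLoc (decays_extend₂ hC) (div_pos hδ hL) (biLoc_extend₂ hW) hδ2 μ 0 ν z
  -- localisation of each `ψ̈`-weighted superposition of first jets: through the dilated data
  have hX : ∀ κ, Loc (wsum (ψ₂ μ 0 ν z κ) (V₁ κ)) := fun κ => by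
    obtain ⟨p, hp⟩ := hψ μ 0 ν z κ
    have hCψ : 0 ≤ Cψ :=
      (mul_nonneg_iff_of_pos_right (Real.exp_pos _)).mp ((abs_nonneg _).trans (hp p))
    rw [← wsum_extend (L := L)]
    -- weights and stencils at the common rate `r := min (mψ / L) δs`
    set r : ℝ := min (mψ / L) δs with hr
    have hr0 : 0 < r := lt_min (div_pos hmψ hL) hδs
    have hw' : ∀ v, |Function.extend (fun u : Site (3 + 1) => (L : ℤ) • u) (ψ₂ μ 0 ν z κ) 0 v|
        ≤ Cψ * Real.exp (-r * l1 (v - (L : ℤ) • p)) := by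
      intro v
      by_cases hv : ∃ u : Site (3 + 1), (L : ℤ) • u = v
      · obtain ⟨u, rfl⟩ := hv
        rw [(zsmul_injective (L := L)).extend_apply]
        have h1 : |ψ₂ μ 0 ν z κ u| ≤ Cψ * Real.exp (-(mψ / L) * l1 ((L : ℤ) • u - (L : ℤ) • p)) := by
          rw [← smul_sub, l1_natSmul]
          have e : -(mψ / L) * ((L : ℝ) * l1 (u - p)) = -mψ * l1 (u - p) := by field_simp
          rw [e]; exact hp u
        refine h1.trans (mul_le_mul_of_nonneg_left (Real.exp_le_exp.2 ?_) hCψ)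
        have hrle : r ≤ mψ / L := min_le_left _ _
        nlinarith [l1_nonneg ((L : ℤ) • u - (L : ℤ) • p)]
      · rw [Function.extend_apply' _ _ _ hv]
        simp only [Pi.zero_apply, abs_zero]
        positivity
    have hV' : ∀ v, BiLoc (Function.extend (fun u : Site (3 + 1) => (L : ℤ) • u) (V₁ κ) 0 v) v v Cs r := by
      intro v
      by_cases hv : ∃ u : Site (3 + 1), (L : ℤ) • u = v
      · obtain ⟨u, rfl⟩ := hv
        rw [(zsmul_injective (L := L)).extend_apply]
        exact OneStepResolventKernel.biLoc_mono (hV κ u) hCs (min_le_right _ _)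
      · rw [Function.extend_apply' _ _ _ hv]
        intro x z' a b
        simp only [Pi.zero_apply, abs_zero]
        positivity
    exact ⟨(L : ℤ) • p, (L : ℤ) • p, _, _, half_pos hr0, OneStepResolventKernel.biLoc_wsum hw' hV' hr0 hCψ⟩
  have hfun : (fun x z' a b => ∑ κ, wsum (ψ₂ μ 0 ν z κ) (V₁ κ) x z' a b)
      = ∑ κ ∈ Finset.univ, wsum (ψ₂ μ 0 ν z κ) (V₁ κ) := by
    funext x z' a b
    simp only [Finset.sum_apply]
  have h₁ : Loc ((fun μ y ν y' => fun x z' a b => ∑ κ, wsum (ψ₂ μ y ν y' κ) (V₁ κ) x z' a b) μ 0 ν z) := by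
    show Loc (fun x z' a b => ∑ κ, wsum (ψ₂ μ 0 ν z κ) (V₁ κ) x z' a b)
    rw [hfun]; exact loc_finset_sum _ hX
  rw [hessKer_add_W hG (vertexOfK C n V₁) μ ν z h₀ h₁, hessKer_nest_eq_dressedEntry hn hG hGcov hC hδ hCcov hwA hV hδs hVcov hW hδ2 hWcov μ ν z]
  congr 1
  rw [hfun, tadpole_finset_sum _ hG hX, Finset.mul_sum]
  refine Finset.sum_congr rfl fun κ _ => ?_
  obtain ⟨p, hp⟩ := hψ μ 0 ν z κ
  rw [tadpole_wsum_scaled (L := L) hG hmψ hp (hV κ) hδs, ← tsum_mul_left]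
  refine tsum_congr fun u => ?_
  ring

/-- [folklore] **… AND WITH A TADPOLE-FREE ONE-STEP LEG THE CROSS TERM VANISHES** (row TAD): if `tadpole G (V₁ κ u) = 0` for every one-step first jet, the
nested kernel with the `ψ̈`-word is the PURE transport `dressedEntry (colOf C) (hessKer G V₁ W₁) (n•z) μ ν`. -/
theorem hessKer_nest_add_eq_transport_of_tadpoleFree (hn : 1 ≤ n) (hG : Spr G)
    (hGcov : ∀ t : Site (3 + 1), shiftK (-((L : ℤ) • t)) G = G)
    {CC δ Cs δs C2 δ2 Cψ mψ : ℝ}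
    (hC : Decays C CC δ) (hδ : 0 < δ) (hCcov : ∀ t : Site (3 + 1), shiftK (-((n : ℤ) • t)) C = C)
    (hwA : ∀ κ l : Fin 4, AbsMoment₂ (colOf C κ l))
    (hV : ∀ κ u, BiLoc (V₁ κ u) ((L : ℤ) • u) ((L : ℤ) • u) Cs δs) (hδs : 0 < δs)
    (hVcov : ∀ κ u t, V₁ κ (u + t) = shiftK (-((L : ℤ) • t)) (V₁ κ u))
    (hW : ∀ κ u l u', BiLoc (W₁ κ u l u') ((L : ℤ) • u) ((L : ℤ) • u') C2 δ2) (hδ2 : 0 < δ2)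
    (hWcov : ∀ κ u l u' t, W₁ κ (u + t) l (u' + t) = shiftK (-((L : ℤ) • t)) (W₁ κ u l u'))
    (ψ₂ : Fin (3 + 1) → Site (3 + 1) → Fin (3 + 1) → Site (3 + 1) → Fin (3 + 1) → Site (3 + 1) → ℝ) (hmψ : 0 < mψ)
    (hψ : ∀ μ y ν y' κ, ∃ p : Site (3 + 1), ∀ u, |ψ₂ μ y ν y' κ u| ≤ Cψ * Real.exp (-mψ * l1 (u - p)))
    (htad : ∀ κ u, tadpole G (V₁ κ u) = 0)
    (μ ν : Fin (3 + 1)) (z : Site (3 + 1)) :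
    hessKer G (vertexOfK C n V₁) (vertex2OfK C n W₁ + fun μ y ν y' => fun x z' a b => ∑ κ, wsum (ψ₂ μ y ν y' κ) (V₁ κ) x z' a b) μ ν z
      = dressedEntry (colOf C) (hessKer G V₁ W₁) ((n : ℤ) • z) μ ν := by
  rw [hessKer_nest_add_eq_transport_add_cross hn hG hGcov hC hδ hCcov hwA hV hδs hVcov hW hδ2 hWcov ψ₂ hmψ hψ μ ν z]
  simp [htad]

end Cross

end Summit.QuantumFields.BalabanUV.Beta.FP.TransportFineFactor

end
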